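import Summits.Parity.GeneralizedHardyLittlewood.Theses.FordMaynardSieveConst01651
import HarnessLib

/-!
# Line `cone_table` — crux `GCert01651` (rank 2) of route `FordMaynardSieveConst01651`
(Parity / GeneralizedHardyLittlewood; item stmt-Parity-19186; line-writer seat
`linewriter-parity-smallroutes-1` g0, 2026-08-31)

LINE.  `GCert01651` (∃ a symmetric, piecewise-constant-on-the-cone `g` with `g(∅) = 1`, support in
`{all xᵢ > ν, Σ xᵢ < 1/2}`, `(𝟙⋆g) ≤ 0` POINTWISE on `ℋ_k = {Σ = 1, ν < xᵢ < 1 − ν}` for every `k ≥ 2`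
and EVERY (not necessarily ordered) `x`, and `V(ν, g) = sieveBoundG1 ν g > 0`, at `ν = 1651/10000`)
  ⇐ `stub_coneCert` = the SAME certificate for RAW CONE DATA `g₀` — a vector function that only has
to be specified (and checked) on ORDERED vectors `x₁ ≤ ⋯ ≤ x_k`, with the `ℋ`-inequality asked only for
ordered `x` and only in the dimensions `2 ≤ k ≤ 6` that can occur —
  + the PROVED symmetrisation step: `g := symmExt g₀`, `g_k(x) := g₀_k(x sorted)`, is symmetric
(`Tuple.comp_perm_comp_sort_eq_comp_sort`), agrees with `g₀` on the cone, inherits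
`IsPiecewiseConstOnCone`, `g(∅) = 1` and the support condition, has the same `sieveBoundG1` (the
integrand of `sieveBoundG1` only reads ordered vectors and ordered subvectors), and satisfies the
`ℋ`-inequality at every `x` because `starSum g k` is permutation invariant for symmetric `g`
(`starSum_perm`, PROVED: re-index the subsets `A ↦ σ(A)` and use symmetry of `g` on each listing).

So the prover of the stub writes the cell table of the certified LP optimiser (evidence
`spec_lp_01651_72.json`, kit j242906: 1370 two-dimensional + 2 three-dimensional cells, exact rationals,
`(𝟙⋆g) ≤ 0` on all 153 050 cell types of `ℋ`, `V = 0.002706498 ± 3.7e−10`) as a function on ORDERED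
vectors only, and proves two numerical facts about it; nothing about permutations remains.
The stub is STRICTLY MORE CONVENIENT than, and implies, the crux; it is not a restatement (the
symmetric-extension and all-`x` obligations are discharged here), and it is the whole remaining
difficulty (ccert class: exact rational table check for `(𝟙⋆g₀) ≤ 0` per cell type incl. faces, and a
two-sided enclosure of ~1.4·10³ log/dilog cell integrals in the tree's `sliceIntegral` normalisation with
total error below the margin 2.7·10⁻³).  Proof class of the line: ccert / kit; the LINE itself is kit 0.
-/

noncomputable section

open Finset
open Literature.NumberTheory.Sieve Literature.NumberTheory.Sieve.FordMaynard

namespace Summit.Parity.GeneralizedHardyLittlewood.Cruxes.GCert01651.ConeTable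

/-! ### Symmetric extension from the ordered cone -/

/-- The symmetric extension of cone data: `symmExt g₀ k x = g₀ k (x sorted increasingly)`. -/
def symmExt (g₀ : VecFn) : VecFn := fun k x => g₀ k (x ∘ ⇑(Tuple.sort x))

theorem symmExt_perm (g₀ : VecFn) (k : ℕ) (σ : Equiv.Perm (Fin k)) (x : Fin k → ℝ) :
    symmExt g₀ k (x ∘ σ) = symmExt g₀ k x := by
  simp only [symmExt]
  rw [Tuple.comp_perm_comp_sort_eq_comp_sort]

/-- `symmExt g₀ ∈ 𝒮` (Definition 6.1). -/
theorem isSymmetric_symmExt (g₀ : VecFn) : (symmExt g₀).IsSymmetric :=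
  fun k σ x => symmExt_perm g₀ k σ x

/-- On ordered vectors the extension is the data. -/
theorem symmExt_of_monotone (g₀ : VecFn) {k : ℕ} {x : Fin k → ℝ} (hx : Monotone x) :
    symmExt g₀ k x = g₀ k x := by
  simp only [symmExt]
  rw [Tuple.sort_eq_refl_iff_monotone.mpr hx]
  simp

/-- On ordered vectors `starSum (symmExt g₀) = starSum g₀` (ordered subvectors of an ordered vector
are ordered). -/
theorem starSum_symmExt_of_monotone (g₀ : VecFn) {k : ℕ} {x : Fin k → ℝ} (hx : Monotone x) :
    starSum (symmExt g₀) k x = starSum g₀ k x := by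
  unfold starSum
  refine Finset.sum_congr rfl fun A _ => ?_
  exact symmExt_of_monotone g₀ (hx.comp (A.orderEmbOfFin rfl).monotone)

/-- The sieve bound only reads ordered vectors: `sieveBoundG1 ν (symmExt g₀) = sieveBoundG1 ν g₀`. -/
theorem sieveBoundG1_symmExt (ν : ℝ) (g₀ : VecFn) :
    sieveBoundG1 ν (symmExt g₀) = sieveBoundG1 ν g₀ := by
  unfold sieveBoundG1
  congr 1
  refine Finset.sum_congr rfl fun k _ => ?_
  congr 1
  funext x
  split_ifs with h
  · rw [starSum_symmExt_of_monotone g₀ h.2]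
  · rfl

/-- `IsPiecewiseConstOnCone` only reads ordered vectors. -/
theorem isPiecewiseConstOnCone_symmExt {g₀ : VecFn} (h : IsPiecewiseConstOnCone g₀) :
    IsPiecewiseConstOnCone (symmExt g₀) := by
  intro k
  obtain ⟨m, P, c, hP, hg⟩ := h k
  exact ⟨m, P, c, hP, fun x hx => by rw [symmExt_of_monotone g₀ hx]; exact hg x hx⟩

/-- The support condition transfers from ordered vectors to all vectors. -/
theorem support_symmExt {ν : ℝ} {g₀ : VecFn}
    (h : ∀ (k : ℕ) (x : Fin k → ℝ), Monotone x → g₀ k x ≠ 0 →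
      k = 0 ∨ ((∀ i, ν < x i) ∧ ∑ i, x i < 1 / 2)) :
    ∀ (k : ℕ) (x : Fin k → ℝ), symmExt g₀ k x ≠ 0 →
      k = 0 ∨ ((∀ i, ν < x i) ∧ ∑ i, x i < 1 / 2) := by
  intro k x hne
  have hmono : Monotone (x ∘ ⇑(Tuple.sort x)) := Tuple.monotone_sort x
  rcases h k _ hmono hne with h0 | ⟨hall, hsum⟩
  · exact Or.inl h0
  · refine Or.inr ⟨fun i => ?_, ?_⟩
    · simpa using hall ((Tuple.sort x).symm i)
    · have : (∑ i, (x ∘ ⇑(Tuple.sort x)) i) = ∑ i, x i := by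
        simp only [Function.comp_apply]
        exact Equiv.sum_comp (Tuple.sort x) x
      rwa [this] at hsum

/-! ### Permutation invariance of `starSum` for symmetric `g` -/

/-- Changing the proof of `B.card = n` / the index `n` along it does not change the `g`-value of the
ordered listing of `x` on `B`. -/
theorem apply_orderEmb_cast (g : VecFn) {k : ℕ} (x : Fin k → ℝ) (B : Finset (Fin k)) {n : ℕ}
    (h : B.card = n) :
    g n (fun i => x (B.orderEmbOfFin h i)) = g B.card (fun i => x (B.orderEmbOfFin rfl i)) := by
  subst h; rfl

/-- For symmetric `g`, the `g`-value of `x` listed along ANY injective enumeration of a finite index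
set `B` equals its value along the increasing enumeration. -/
theorem apply_comp_eq_of_range {g : VecFn} (hs : g.IsSymmetric) {k : ℕ} (x : Fin k → ℝ)
    (B : Finset (Fin k)) {n : ℕ} (hB : B.card = n) (f : Fin n → Fin k)
    (hf : Function.Injective f) (hmem : ∀ i, f i ∈ B) :
    g n (x ∘ f) = g n (fun i => x (B.orderEmbOfFin hB i)) := by
  let π₀ : Fin n → Fin n := fun i => (B.orderIsoOfFin hB).symm ⟨f i, hmem i⟩
  have hπ₀ : Function.Injective π₀ := by
    intro i j hij
    have h1 := congrArg (fun t => ((B.orderIsoOfFin hB) t : Fin k)) hij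
    simp only [π₀, OrderIso.apply_symm_apply] at h1
    exact hf h1
  let π : Equiv.Perm (Fin n) := Equiv.ofBijective π₀ (Finite.injective_iff_bijective.mp hπ₀)
  have hcomp : (fun i => x (B.orderEmbOfFin hB i)) ∘ ⇑π = x ∘ f := by
    funext i
    simp only [Function.comp_apply, π, Equiv.ofBijective_apply, π₀]
    rw [← Finset.coe_orderIsoOfFin_apply, OrderIso.apply_symm_apply]
  rw [← hcomp, hs n π]

/-- **`(𝟙⋆g)` is permutation invariant for `g ∈ 𝒮`** (Definition 7.1 with Definition 6.1):
`starSum g k (x ∘ σ) = starSum g k x`. -/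
theorem starSum_perm {g : VecFn} (hs : g.IsSymmetric) (k : ℕ) (σ : Equiv.Perm (Fin k))
    (x : Fin k → ℝ) : starSum g k (x ∘ σ) = starSum g k x := by
  unfold starSum
  rw [← Equiv.sum_comp (Equiv.finsetCongr σ)
    (fun B : Finset (Fin k) => g B.card (fun i => x (B.orderEmbOfFin rfl i)))]
  refine Finset.sum_congr rfl fun A _ => ?_
  have hB : ((Equiv.finsetCongr σ) A).card = A.card := by
    simp only [Equiv.finsetCongr_apply, Finset.card_map]
  have hmem : ∀ i, (⇑σ ∘ ⇑(A.orderEmbOfFin rfl)) i ∈ (Equiv.finsetCongr σ) A := by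
    intro i
    simp only [Function.comp_apply, Equiv.finsetCongr_apply, Finset.mem_map_equiv,
      Equiv.symm_apply_apply]
    exact A.orderEmbOfFin_mem rfl i
  have key := apply_comp_eq_of_range hs x ((Equiv.finsetCongr σ) A) hB
    (⇑σ ∘ ⇑(A.orderEmbOfFin rfl)) (σ.injective.comp (A.orderEmbOfFin rfl).injective) hmem
  rw [apply_orderEmb_cast g x ((Equiv.finsetCongr σ) A) hB] at key
  exact key

/-! ### The `ℋ`-inequality: from ordered vectors in dimensions `2 … 6` to all vectors -/

/-- No vector of dimension `k ≥ 7` has all components `> 1651/10000` and sum `1`. -/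
theorem dim_le_six {k : ℕ} {x : Fin k → ℝ} (hbox : ∀ i, (1651 / 10000 : ℝ) < x i)
    (hsum : ∑ i, x i = 1) : k ≤ 6 := by
  by_contra hk
  have hk7 : 7 ≤ k := by omega
  have hlt : ∑ _i : Fin k, (1651 / 10000 : ℝ) < ∑ i, x i := by
    haveI : Nonempty (Fin k) := ⟨⟨0, by omega⟩⟩
    exact Finset.sum_lt_sum_of_nonempty Finset.univ_nonempty fun i _ => hbox i
  rw [Finset.sum_const, Finset.card_univ, Fintype.card_fin, nsmul_eq_mul, hsum] at hlt
  have : (7 : ℝ) ≤ k := by exact_mod_cast hk7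
  nlinarith

/-- The `ℋ`-inequality for `symmExt g₀` at every `x`, from the inequality for `g₀` at ordered `x` in
dimensions `2 ≤ k ≤ 6`. -/
theorem starSum_nonpos_of_cone {g₀ : VecFn}
    (hH : ∀ k : ℕ, 2 ≤ k → k ≤ 6 → ∀ x : Fin k → ℝ, Monotone x →
      (∀ i, (1651 / 10000 : ℝ) < x i ∧ x i < 1 - 1651 / 10000) → ∑ i, x i = 1 →
        starSum g₀ k x ≤ 0) :
    ∀ k : ℕ, 2 ≤ k → ∀ x : Fin k → ℝ,
      (∀ i, (1651 / 10000 : ℝ) < x i ∧ x i < 1 - 1651 / 10000) → ∑ i, x i = 1 →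
        starSum (symmExt g₀) k x ≤ 0 := by
  intro k hk x hbox hsum
  have hk6 : k ≤ 6 := dim_le_six (fun i => (hbox i).1) hsum
  rw [← starSum_perm (isSymmetric_symmExt g₀) k (Tuple.sort x) x,
    starSum_symmExt_of_monotone g₀ (Tuple.monotone_sort x)]
  refine hH k hk hk6 _ (Tuple.monotone_sort x) (fun i => hbox _) ?_
  have : (∑ i, (x ∘ ⇑(Tuple.sort x)) i) = ∑ i, x i := by
    simp only [Function.comp_apply]
    exact Equiv.sum_comp (Tuple.sort x) x
  rw [this, hsum]

/-! ### The stub and the composition -/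

/-- Stub statement: the certificate on CONE DATA at `ν = 1651/10000`. -/
def Signature.stub_coneCert : Prop :=
  ∃ g₀ : VecFn, IsPiecewiseConstOnCone g₀ ∧ (∀ e : Fin 0 → ℝ, g₀ 0 e = 1) ∧
    (∀ (k : ℕ) (x : Fin k → ℝ), Monotone x → g₀ k x ≠ 0 →
      k = 0 ∨ ((∀ i, (1651 / 10000 : ℝ) < x i) ∧ ∑ i, x i < 1 / 2)) ∧
    (∀ k : ℕ, 2 ≤ k → k ≤ 6 → ∀ x : Fin k → ℝ, Monotone x →
      (∀ i, (1651 / 10000 : ℝ) < x i ∧ x i < 1 - 1651 / 10000) → ∑ i, x i = 1 →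
        starSum g₀ k x ≤ 0) ∧
    0 < sieveBoundG1 (1651 / 10000) g₀

/-- **The open stub** (XL, ccert class): some cone data `g₀` — in each dimension a finite rational
combination of indicators of convex polytopes of the ordered cone (`IsPiecewiseConstOnCone`) — with
`g₀(∅) = 1`, supported (on ordered vectors) in `{all xᵢ > 0.1651, Σ xᵢ < 1/2}`, such that for every
`2 ≤ k ≤ 6` and every ORDERED `x` with `Σ xᵢ = 1`, `0.1651 < xᵢ < 0.8349`, `starSum g₀ k x ≤ 0`, and
`0 < sieveBoundG1 (1651/10000) g₀`.  Intended witness: the cell table of `spec_lp_01651_72.json`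
(kit j242906), read on ordered vectors. -/
theorem stub_coneCert :
    ∃ g₀ : VecFn, IsPiecewiseConstOnCone g₀ ∧ (∀ e : Fin 0 → ℝ, g₀ 0 e = 1) ∧
      (∀ (k : ℕ) (x : Fin k → ℝ), Monotone x → g₀ k x ≠ 0 →
        k = 0 ∨ ((∀ i, (1651 / 10000 : ℝ) < x i) ∧ ∑ i, x i < 1 / 2)) ∧
      (∀ k : ℕ, 2 ≤ k → k ≤ 6 → ∀ x : Fin k → ℝ, Monotone x →
        (∀ i, (1651 / 10000 : ℝ) < x i ∧ x i < 1 - 1651 / 10000) → ∑ i, x i = 1 →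
          starSum g₀ k x ≤ 0) ∧
      0 < sieveBoundG1 (1651 / 10000) g₀ := by
  sorry

example : Signature.stub_coneCert := stub_coneCert

/-- **Composition (kernel-checked)**: the cone-data certificate gives the ROUTE crux BY NAME, through
the proved symmetrisation. -/
theorem GCert01651_of :
    Signature.stub_coneCert →
      Summit.Parity.GeneralizedHardyLittlewood.Theses.FordMaynardSieveConst01651.GCert01651 := by
  rintro ⟨g₀, hpc, h0, hsupp, hH, hV⟩
  refine ⟨symmExt g₀, isSymmetric_symmExt g₀, isPiecewiseConstOnCone_symmExt hpc, fun e => h0 _,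
    support_symmExt hsupp, starSum_nonpos_of_cone hH, ?_⟩
  rw [sieveBoundG1_symmExt]
  exact hV

/-- **The skeleton instantiated**: the crux BY NAME modulo the single registered stub. -/
theorem GCert01651_of_stubs :
    Summit.Parity.GeneralizedHardyLittlewood.Theses.FordMaynardSieveConst01651.GCert01651 :=
  GCert01651_of stub_coneCert

end Summit.Parity.GeneralizedHardyLittlewood.Cruxes.GCert01651.ConeTable

end
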